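import Summits.BirchSwinnertonDyer.BirchSwinnertonDyer.Theorems.CongruentShaFreeCutBDPUpToRigidityReadings
import Summits.BirchSwinnertonDyer.BirchSwinnertonDyer.Theorems.CongruentShaFreeCutCharacterSupply

set_option linter.dupNamespace false
set_option autoImplicit false

/-! # Route `CongruentShaFreeCut` (rung S2) — LEMMA R's character supply DISCHARGED at `p = 2`: the
registered ∀-frame ♯ stub `TwoAdicBDPValueAtOneUpTo` (stmt-BirchSwinnertonDyer-19079, line
`heegner-field-bdp-triple-upto` v6cp) follows from «ONE admissible ♯ tuple WITH its value at 𝟙 at every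
`ι'`» ALONE

Cell `bsd-cn100`, prover seat `bsd-cn100-s2b-c3` (g7), serving the S2 row (twin of the S2b file
`MordellShaFreeCutThreeAdicBDPValueRigiditySupplied.lean`). Supports, does not close,
stmt-BirchSwinnertonDyer-19079. The reading of record
`CongruentShaFreeCutBDPUpToRigidity.twoAdicBDPValueAtOneUpTo_of_frameValue_of_supply` (transfer g11,
`CongruentShaFreeCutBDPUpToRigidityReadings.lean`: MEMO-transfer-13 THEOREM 13.2 ⟸ THEOREM 13.1 + (5.3.1) +
LEMMA R) carries the CHARACTER SUPPLY at `(K, ι', κ, γ)` as a hypothesis `hsup` («the tree does not construct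
Hecke characters of prescribed infinity type»). It does, since 2026-08-26: the cell's own `p = 2` port
`…Theorems.CongruentShaFreeCutCharacterSupply.characterSupplyAt` (transfer g8; x11b3's S24-a λ-supply +
multr1's powers `φ₀^{p^k}`, `φ₀^{2p^k}`, valid at EVERY prime) is that binder VERBATIM at `p = 2`. Hence:

* `twoAdicBDPValueAtOneUpTo_of_frameValue` — **(LB-bdp♯) ∀-frame `TwoAdicBDPValueAtOneUpTo` ⟸ (h12♯): for
  the stub's binders and every `ι'` inducing `v`, ONE admissible `(Ω_K, Ω_p, C ≠ 0, 𝓛)` WITH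
  `𝓛(𝟙) = u·c⁻²·(1 − a₂2⁻¹ + [2 ∤ N]2⁻¹)²·(log_ω P)²`, `u ≠ 0`** — NO supply hypothesis. So the ∀-quantifier
  of the typed (LB-bdp♯) carries no research content: what MEMO-transfer-13 §§2–5.3 WRITES (one tuple with
  its value) is, in the kernel, equivalent to the registered ∀-form given frames at every `ι'`.

HONEST FRAMING: a CONDITIONAL reduction over tree theorems; nothing here proves (LB-exist♯), (LB-wan♯),
(LB-bdp♯), crux A, crux B, the leaf `rankOne_twoConverse_congruentNumber`, the congruent number problem
or any case of BSD; (h12♯) is a HYPOTHESIS (research-note grade in writing, MEMO-transfer-13).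
PARTITION: none — RANK axis.

[cite: Castella2018, Thm. 3.1–3.2 (arXiv:1704.06608 pp. 8–9) (shape only; nothing asserted at p = 2)]
[cite: BertoliniDarmonPrasanna2013, Thm. 5.13 (shape of the value at the trivial character)]
[cite: Washington1997, §13.1 (anticyclotomic characters; the supply)] -/

noncomputable section

open scoped Classical Topology

namespace Summit.BirchSwinnertonDyer.BirchSwinnertonDyer.Theorems.CongruentShaFreeCutBDPUpToRigiditySupplied

open Filter PowerSeries WeierstrassCurve NumberField IsDedekindDomain Field
  Literature.NumberTheory.EllipticCurves Literature.NumberTheory.EllipticCurves.ModularForms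
  Literature.NumberTheory.QuadraticFields Literature.NumberTheory.EllipticCurves.Castella2018
open Literature.NumberTheory.GaloisRepresentations Literature.NumberTheory.GaloisCohomology
open Summit.BirchSwinnertonDyer.BirchSwinnertonDyer.Theorems.CongruentShaFreeCutTwoAdicBDPTripleUpTo
  (TwoAdicBDPValueAtOneUpTo)
open Summit.BirchSwinnertonDyer.BirchSwinnertonDyer.Theorems.CongruentShaFreeCutBDPUpToRigidity
  (twoAdicBDPValueAtOneUpTo_of_frameValue_of_supply)
open Summit.BirchSwinnertonDyer.BirchSwinnertonDyer.Theorems.CongruentShaFreeCutCharacterSupply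
  (characterSupplyAt)

/-- **(LB-bdp♯) ∀-frame `TwoAdicBDPValueAtOneUpTo` ⟸ the one-♯-tuple-with-value statement at every `ι'`,
with NO character-supply hypothesis**: transfer g11's reading
`twoAdicBDPValueAtOneUpTo_of_frameValue_of_supply` (LEMMA R of MEMO-transfer-13 §5.4 in the ♯ frame:
`[T⁰]𝓛' = (C'/C)·[T⁰]𝓛`) fed with the cell's character-supply THEOREM
`CongruentShaFreeCutCharacterSupply.characterSupplyAt` at `p = 2`. (h12♯) (inline, the binders of the
reading of record verbatim) is a HYPOTHESIS — what a construction delivers; nothing is asserted at `p = 2`.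
[cite: Castella2018, Thm. 3.1–3.2 (arXiv:1704.06608 pp. 8–9) (shape only; nothing asserted)]
[cite: Washington1997, §13.1 (the supply)] -/
theorem twoAdicBDPValueAtOneUpTo_of_frameValue
    (h12 : ∀ ⦃n : ℕ⦄, Squarefree n →
      ∀ [(congruentNumberCurve n).IsElliptic] [(congruentNumberCurve n).IsGloballyMinimal]
        (ι' : PadicAlgCl 2 ≃+* ℂ) (K : Type) [Field K] [NumberField K] (N : ℕ) [NeZero N]
        (Dt : ModularParametrizationData (congruentNumberCurve n) N)
        (H : HeegnerDatum N (NumberField.discr K)) (w : InfinitePlace K) (e : K →+* ℚ_[2])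
        (v : HeightOneSpectrum (𝓞 K)) (κ : ZpExtension K 2) (γ : absoluteGaloisGroup K)
        [Fact (κ.IsTopGenerator γ)] (P : ((congruentNumberCurve n).baseChange K).toAffine.Point),
      (congruentNumberCurve n).conductorNorm ℤ = N → IsImaginaryQuadratic K →
      SatisfiesHeegnerHypothesis N K → ((Ideal.span {(2 : ℤ)}).primesOver (𝓞 K)).ncard = 2 →
      ((2 : ℕ) : 𝓞 K) ∈ v.asIdeal →
      (∀ (w' : InfinitePlace K) (k : 𝓞 K), k ∈ v.asIdeal ↔ ‖ι'.symm (w'.embedding (k : K))‖ < 1) →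
      κ.IsAnticyclotomic →
      WeierstrassCurve.Affine.Point.map w.embedding.toRatAlgHom P = heegnerPointComplex Dt H →
      (∀ k : 𝓞 K, k ∈ v.asIdeal ↔ ‖e (k : K)‖ < 1) →
      ∃ (ΩK : ℂ) (Ωp : (unrIntegers 2)ˣ) (C : ℂ_[2]) (L : UnrSeries 2),
        ΩK ≠ 0 ∧ C ≠ 0 ∧ IsBDPLFunctionUpTo C ι' v κ γ Dt.f ΩK ((Ωp : unrIntegers 2) : ℂ_[2]) L ∧
        ∃ u : ℂ_[2], u ≠ 0 ∧ L.HasValueAt 0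
          (u * algebraMap ℚ_[2] ℂ_[2] (((Dt.c : ℚ_[2])⁻¹) ^ 2 *
            (1 - ((congruentNumberCurve n).LFunction 2 : ℚ_[2]) * (2 : ℚ_[2])⁻¹ +
              (if (2 : ℕ) ∣ N then 0 else (2 : ℚ_[2])⁻¹)) ^ 2 *
            (padicLogOmega (congruentNumberCurve n) 2 e P) ^ 2))) :
    TwoAdicBDPValueAtOneUpTo :=
  twoAdicBDPValueAtOneUpTo_of_frameValue_of_supply (characterSupplyAt (p := 2)) h12

end Summit.BirchSwinnertonDyer.BirchSwinnertonDyer.Theorems.CongruentShaFreeCutBDPUpToRigiditySupplied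

end
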